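import Literature.Analysis.FluidPDE.RieszPressureAEConvergence
import Literature.Analysis.FluidPDE.LocalLerayPressureDecomposition
import HarnessLib

/-!
# Discharge of `stein1970_normalisedPressure_ae_Lp_bound` (Stein 1970, Ch. II §4.2 Thm 3 (b) with
§4.5 Thm 4 (a) for the Riesz-type kernels of the normalised pressure on the `L^p` class)

Analysis/FluidPDE proof file (theorems only), sibling of `LocalLerayPressureDecomposition.lean`,
whose named fact **CZ** `Literature.Analysis.FluidPDE.stein1970_normalisedPressure_ae_Lp_bound`
(for `1 < p < ∞` there is `C` such that for every measurable `w : ℝ³ → ℝ³` with `|w|² ∈ L^p` the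
principal value `p.v.∫ K(x-y)(w(y)) dy` exists for a.e. `x` and
`‖p̃[w]‖_p ≤ C‖|w|²‖_p`, `p̃[w] = -|w|²/3 + p.v.∫ K(x-y)(w(y)) dy` the normalised pressure) is
PROVED here (`stein1970_normalisedPressure_ae_Lp_bound_holds`), completing the stack

  `SingularIntegrals/HardyLittlewoodMaximal`, `MaximalFunctionDomination` (maximal function) →
  `RieszPressureTruncations` (Thm 3 (a): `‖T^a_ε h‖_p ≤ A‖h‖_p` on `L^p`) →
  `RieszPressureCotlar` (p.v. on `C¹_c`, Cotlar `T* ≤ c₁M(T·) + c₂M`, Thm 4 (c) on `C¹_c`) →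
  `RieszPressureAEConvergence` (Thm 4 (c), (a) on `L^p`) → this file.

## The assembly (polarisation, as in `NormalisedPressureLpBoundProofs`)

The quadratic kernel is a combination of the directional kernels: with the symmetric bilinear
form `B_z` of `NormalisedPressurePV` (`pressureForm`, `K(z)(v) = B_z(v,v)`) and the orthonormal
basis `b`, `K(z)(v) = Σᵢⱼ vᵢvⱼ B_z(bᵢ,bⱼ)` and `B_z(bᵢ,bⱼ) = ½(K(z)(bᵢ+bⱼ) - K(z)(bᵢ) - K(z)(bⱼ))`
(`pressureKernel_eq_sum_coordProd`), so for `|w|² ∈ L^p` (whence `wᵢwⱼ ∈ L^p`) and `ε > 0`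

  `∫_{|x-y|>ε} K(x-y)(w(y)) dy = ½ Σᵢⱼ (T^{bᵢ+bⱼ}_ε - T^{bᵢ}_ε - T^{bⱼ}_ε)(wᵢwⱼ)(x)`

(`truncatedPressureIntegral_eq_sum_rieszTrunc`, each truncated integrand integrable by Hölder).
Theorem 4 (a) for the 27 scalar truncations gives the limit `ε → 0⁺` at a.e. `x`, i.e.
`HasPressurePV w x L` a.e. (`ae_exists_hasPressurePV`); at such `x`,
`p̃[w](x) = -|w(x)|²/3 + L(x)` with `L = lim_n` of the truncations at `ε = 1/(n+1)`, whose `L^p`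
norms are `≤ (27/2)A‖|w|²‖_p` by Theorem 3 (a) on `L^p` (`exists_eLpNorm_rieszTrunc_le`), so
Fatou gives `‖p̃[w]‖_p ≤ (1/3 + 27A/2)‖|w|²‖_p`.

## Mathlib / tree

`ae_all_iff`, `Lp.eLpNorm_lim_le_liminf_eLpNorm`, `aestronglyMeasurable_of_tendsto_ae`,
`eLpNorm_congr_ae`, `OrthonormalBasis.sum_repr'` (used). Tree: `pressureForm`,
`pressureKernel_eq_pressureForm` (`NormalisedPressurePV`), `coord`, `coordProd`, `abs_coordProd_le`
(`NormalisedPressureL2Bound`), `truncatedPressureIntegral`, `HasPressurePV`, `normalisedPressure_eq`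
(`NormalisedPressure`), `rieszTrunc_eq_setIntegral`, `integrable_mul_rieszTruncKernel`,
`aestronglyMeasurable_rieszTrunc`, `exists_eLpNorm_rieszTrunc_le` (`RieszPressureTruncations`),
`integrableOn_mul_rieszKernel_iff` (`RieszPressureCotlar`), `ae_exists_tendsto_rieszTrunc`
(`RieszPressureAEConvergence`).

## References

* E. M. Stein, *Singular integrals and differentiability properties of functions*, Princeton
  Math. Series 30 (1970): Ch. II §4.2 Theorem 3 (b), §4.5 Theorem 4 (a). [`Stein1971`]
* K. Kang, H. Miura, T.-P. Tsai, IMRN 2021 = arXiv:1812.10509, §8 ("By the Calderon–Zygmund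
  estimate, `∫_{B_{3R/2}} |p_loc|^q ≤ c_q ∫_{B_{3R}} |v|^{2q}`"). [`KangMiuraTsai2020`]
-/

noncomputable section

open MeasureTheory Set Filter Topology Function Metric
open scoped ENNReal NNReal RealInnerProductSpace ContDiff Convolution

namespace Literature.Analysis.FluidPDE

/-- Local notation for physical space `ℝ³ = EuclideanSpace ℝ (Fin 3)`. -/
local notation "ℝ³" => EuclideanSpace ℝ (Fin 3)

-- nested operator types `ℝ³ →L[ℝ] ℝ³ →L[ℝ] ℝ` in the imported pressure files
set_option maxSynthPendingDepth 3

/-! ## §1. The bilinear form and polarisation of the quadratic kernel -/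

section Polarisation

/-- Symmetry of the bilinear form behind the pressure kernel. [folklore] -/
theorem pressureForm_symm (z a c : ℝ³) : pressureForm z a c = pressureForm z c a := by
  simp only [pressureForm, real_inner_comm a c]
  ring

/-- Additivity of `B_z` in the first slot. [folklore] -/
theorem pressureForm_add_left (z a a' c : ℝ³) :
    pressureForm z (a + a') c = pressureForm z a c + pressureForm z a' c := by
  simp only [pressureForm, inner_add_right, inner_add_left]
  ring

/-- Homogeneity of `B_z` in the first slot. [folklore] -/
theorem pressureForm_smul_left (z : ℝ³) (r : ℝ) (a c : ℝ³) :
    pressureForm z (r • a) c = r * pressureForm z a c := by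
  simp only [pressureForm, inner_smul_right, real_inner_smul_left]
  ring

/-- `B_z(0, c) = 0`. [folklore] -/
theorem pressureForm_zero_left (z c : ℝ³) : pressureForm z 0 c = 0 := by
  have h := pressureForm_smul_left z 0 0 c
  rwa [zero_smul, zero_mul] at h

/-- `B_z` of a finite sum in the first slot. [folklore] -/
theorem pressureForm_sum_left {ι : Type*} (s : Finset ι) (v : ι → ℝ³) (z c : ℝ³) :
    pressureForm z (∑ i ∈ s, v i) c = ∑ i ∈ s, pressureForm z (v i) c := by
  classical
  induction s using Finset.induction_on with
  | empty => simp [pressureForm_zero_left]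
  | insert i s hi ih => rw [Finset.sum_insert hi, Finset.sum_insert hi, pressureForm_add_left, ih]

/-- `B_z` of a finite sum in the second slot. [folklore] -/
theorem pressureForm_sum_right {ι : Type*} (s : Finset ι) (v : ι → ℝ³) (z a : ℝ³) :
    pressureForm z a (∑ i ∈ s, v i) = ∑ i ∈ s, pressureForm z a (v i) := by
  rw [pressureForm_symm, pressureForm_sum_left]
  exact Finset.sum_congr rfl fun i _ => pressureForm_symm _ _ _

/-- **Polarisation:** `B_z(u, v) = ½(K(z)(u+v) - K(z)(u) - K(z)(v))`. [folklore] -/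
theorem pressureForm_eq_polarisation (z u v : ℝ³) :
    pressureForm z u v = 2⁻¹ * (pressureKernel z (u + v) - pressureKernel z u - pressureKernel z v) := by
  rw [pressureKernel_eq_pressureForm, pressureKernel_eq_pressureForm, pressureKernel_eq_pressureForm,
    pressureForm_add_left, pressureForm_symm z u (u + v), pressureForm_symm z v (u + v),
    pressureForm_add_left, pressureForm_add_left, pressureForm_symm z v u]
  ring

/-- **Expansion of the quadratic kernel along the orthonormal basis:**
`K(z)(w(y)) = Σᵢⱼ wᵢ(y)wⱼ(y) · ½(K(z)(bᵢ+bⱼ) - K(z)(bᵢ) - K(z)(bⱼ))`. [folklore] -/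
theorem pressureKernel_eq_sum_coordProd (z : ℝ³) (w : ℝ³ → ℝ³) (y : ℝ³) :
    pressureKernel z (w y) = ∑ i, ∑ j, coordProd w i j y *
      (2⁻¹ * (pressureKernel z (stdOrthonormalBasis ℝ ℝ³ i + stdOrthonormalBasis ℝ ℝ³ j) -
        pressureKernel z (stdOrthonormalBasis ℝ ℝ³ i) - pressureKernel z (stdOrthonormalBasis ℝ ℝ³ j))) := by
  set b := stdOrthonormalBasis ℝ ℝ³
  have hw : w y = ∑ i, ⟪w y, b i⟫ • b i := by
    conv_lhs => rw [← b.sum_repr' (w y)]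
    exact Finset.sum_congr rfl fun i _ => by rw [real_inner_comm]
  rw [pressureKernel_eq_pressureForm]
  conv_lhs => rw [hw]
  rw [pressureForm_sum_left]
  refine Finset.sum_congr rfl fun i _ => ?_
  rw [pressureForm_smul_left, pressureForm_sum_right, Finset.mul_sum]
  refine Finset.sum_congr rfl fun j _ => ?_
  rw [pressureForm_symm, pressureForm_smul_left, pressureForm_symm, pressureForm_eq_polarisation, coordProd,
    coord, coord]
  ring

end Polarisation

/-! ## §2. The truncated quadratic integral as a sum of directional truncations -/

section Truncated

variable {p q : ℝ≥0∞} {w : ℝ³ → ℝ³}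

/-- The products `wᵢwⱼ` are a.e.-strongly measurable. [folklore] -/
theorem aestronglyMeasurable_coordProd (hw : AEStronglyMeasurable w volume) (i j : Fin (Module.finrank ℝ ℝ³)) :
    AEStronglyMeasurable (coordProd w i j) volume :=
  (hw.inner aestronglyMeasurable_const).mul (hw.inner aestronglyMeasurable_const)

/-- `wᵢwⱼ ∈ L^p` when `|w|² ∈ L^p` (`|wᵢwⱼ| ≤ |w|²`). [folklore] -/
theorem memLp_coordProd (hw : AEStronglyMeasurable w volume) (hw2 : MemLp (fun x => ‖w x‖ ^ 2) p volume)
    (i j : Fin (Module.finrank ℝ ℝ³)) : MemLp (coordProd w i j) p volume :=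
  hw2.of_le (aestronglyMeasurable_coordProd hw i j) (Eventually.of_forall fun y => by
    rw [Real.norm_eq_abs, Real.norm_eq_abs, abs_of_nonneg (sq_nonneg ‖w y‖)]
    exact abs_coordProd_le w i j y)

/-- `‖wᵢwⱼ‖_p ≤ ‖|w|²‖_p`. [folklore] -/
theorem eLpNorm_coordProd_le (w : ℝ³ → ℝ³) (i j : Fin (Module.finrank ℝ ℝ³)) (p : ℝ≥0∞) :
    eLpNorm (coordProd w i j) p volume ≤ eLpNorm (fun x => ‖w x‖ ^ 2) p volume :=
  eLpNorm_mono_real fun y => by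
    rw [Real.norm_eq_abs]
    exact abs_coordProd_le w i j y

/-- The directions of the polarisation have norm at most `2`. [folklore] -/
theorem norm_stdOrthonormalBasis_le (i : Fin (Module.finrank ℝ ℝ³)) : ‖stdOrthonormalBasis ℝ ℝ³ i‖ ≤ 2 := by
  rw [(stdOrthonormalBasis ℝ ℝ³).orthonormal.1]; norm_num

/-- The directions of the polarisation have norm at most `2`. [folklore] -/
theorem norm_stdOrthonormalBasis_add_le (i j : Fin (Module.finrank ℝ ℝ³)) :
    ‖stdOrthonormalBasis ℝ ℝ³ i + stdOrthonormalBasis ℝ ℝ³ j‖ ≤ 2 :=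
  (norm_add_le _ _).trans (by
    rw [(stdOrthonormalBasis ℝ ℝ³).orthonormal.1, (stdOrthonormalBasis ℝ ℝ³).orthonormal.1]; norm_num)

/-- Integrability of `wᵢwⱼ(y) K(x-y)(a)` on the truncation region for `wᵢwⱼ ∈ L^p` (Hölder). [folklore] -/
theorem integrableOn_coordProd_mul_pressureKernel [hpq : ENNReal.HolderConjugate p q] (hq : 1 < q) (hq' : q ≠ ⊤)
    (hw : AEStronglyMeasurable w volume) (hw2 : MemLp (fun x => ‖w x‖ ^ 2) p volume)
    (i j : Fin (Module.finrank ℝ ℝ³)) (a x : ℝ³) {ε : ℝ} (hε : 0 < ε) :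
    IntegrableOn (fun y => coordProd w i j y * pressureKernel (x - y) a) (closedBall x ε)ᶜ volume :=
  (integrableOn_mul_rieszKernel_iff a _ x ε).2
    (integrable_mul_rieszTruncKernel hq hq' (memLp_coordProd hw hw2 i j) hε a x)

/-- **The truncated integrand of the normalised pressure as a sum of directional pieces**
(pointwise). [folklore] -/
theorem pressureKernel_apply_eq_sum (w : ℝ³ → ℝ³) (x y : ℝ³) :
    pressureKernel (x - y) (w y) = ∑ i, ∑ j, 2⁻¹ * (coordProd w i j y *
      pressureKernel (x - y) (stdOrthonormalBasis ℝ ℝ³ i + stdOrthonormalBasis ℝ ℝ³ j) -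
        coordProd w i j y * pressureKernel (x - y) (stdOrthonormalBasis ℝ ℝ³ i) -
        coordProd w i j y * pressureKernel (x - y) (stdOrthonormalBasis ℝ ℝ³ j)) := by
  rw [pressureKernel_eq_sum_coordProd]
  refine Finset.sum_congr rfl fun i _ => Finset.sum_congr rfl fun j _ => ?_
  ring

/-- **Integrability of the truncated quadratic integrand** `y ↦ K(x-y)(w(y))` on `{|x-y| > ε}`
for measurable `w` with `|w|² ∈ L^p`, `1 < p < ∞`, every `x` and every `ε > 0` (Stein's "the
integral converges absolutely for every `x`"). [cite: Stein1971, Ch. II §4.5 Thm 4] -/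
theorem integrableOn_pressureKernel_of_memLp [hpq : ENNReal.HolderConjugate p q] (hq : 1 < q) (hq' : q ≠ ⊤)
    (hw : AEStronglyMeasurable w volume) (hw2 : MemLp (fun x => ‖w x‖ ^ 2) p volume) (x : ℝ³) {ε : ℝ}
    (hε : 0 < ε) : IntegrableOn (fun y => pressureKernel (x - y) (w y)) (closedBall x ε)ᶜ volume := by
  set b := stdOrthonormalBasis ℝ ℝ³
  have hfun : (fun y => pressureKernel (x - y) (w y)) = fun y => ∑ i, ∑ j, 2⁻¹ * (coordProd w i j y *
      pressureKernel (x - y) (b i + b j) - coordProd w i j y * pressureKernel (x - y) (b i) -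
        coordProd w i j y * pressureKernel (x - y) (b j)) := funext fun y => pressureKernel_apply_eq_sum w x y
  rw [hfun]
  refine integrable_finsetSum _ fun i _ => integrable_finsetSum _ fun j _ => ?_
  have h := fun a => integrableOn_coordProd_mul_pressureKernel hq hq' hw hw2 i j a x hε
  exact (((h _).sub (h _)).sub (h _)).const_mul _

/-- **The truncated singular integral of the normalised pressure is a combination of the
directional truncations:** for measurable `w` with `|w|² ∈ L^p` and `ε > 0`,
`∫_{|x-y|>ε} K(x-y)(w(y)) dy = ½ Σᵢⱼ (T^{bᵢ+bⱼ}_ε - T^{bᵢ}_ε - T^{bⱼ}_ε)(wᵢwⱼ)(x)`. [folklore] -/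
theorem truncatedPressureIntegral_eq_sum_rieszTrunc [hpq : ENNReal.HolderConjugate p q] (hq : 1 < q) (hq' : q ≠ ⊤)
    (hw : AEStronglyMeasurable w volume) (hw2 : MemLp (fun x => ‖w x‖ ^ 2) p volume) (x : ℝ³) {ε : ℝ}
    (hε : 0 < ε) :
    truncatedPressureIntegral w x ε = ∑ i, ∑ j, 2⁻¹ *
      (rieszTrunc (stdOrthonormalBasis ℝ ℝ³ i + stdOrthonormalBasis ℝ ℝ³ j) ε (coordProd w i j) x -
        rieszTrunc (stdOrthonormalBasis ℝ ℝ³ i) ε (coordProd w i j) x -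
        rieszTrunc (stdOrthonormalBasis ℝ ℝ³ j) ε (coordProd w i j) x) := by
  set b := stdOrthonormalBasis ℝ ℝ³
  have hI := fun i j a => integrableOn_coordProd_mul_pressureKernel hq hq' hw hw2 i j a x hε
  have hterm : ∀ i j, IntegrableOn (fun y => 2⁻¹ * (coordProd w i j y * pressureKernel (x - y) (b i + b j) -
      coordProd w i j y * pressureKernel (x - y) (b i) - coordProd w i j y * pressureKernel (x - y) (b j)))
      (closedBall x ε)ᶜ :=
    fun i j => (((hI i j _).sub (hI i j _)).sub (hI i j _)).const_mul _
  have hij : ∀ i j, ∫ y in (closedBall x ε)ᶜ, 2⁻¹ * (coordProd w i j y * pressureKernel (x - y) (b i + b j) -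
      coordProd w i j y * pressureKernel (x - y) (b i) - coordProd w i j y * pressureKernel (x - y) (b j)) =
      2⁻¹ * (rieszTrunc (b i + b j) ε (coordProd w i j) x - rieszTrunc (b i) ε (coordProd w i j) x -
        rieszTrunc (b j) ε (coordProd w i j) x) := by
    intro i j
    have h12 : IntegrableOn (fun y => coordProd w i j y * pressureKernel (x - y) (b i + b j) -
        coordProd w i j y * pressureKernel (x - y) (b i)) (closedBall x ε)ᶜ := (hI i j _).sub (hI i j _)
    rw [integral_const_mul, integral_sub h12 (hI i j _), integral_sub (hI i j _) (hI i j _),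
      rieszTrunc_eq_setIntegral, rieszTrunc_eq_setIntegral, rieszTrunc_eq_setIntegral]
  rw [truncatedPressureIntegral]
  calc ∫ y in (closedBall x ε)ᶜ, pressureKernel (x - y) (w y)
      = ∫ y in (closedBall x ε)ᶜ, ∑ i, ∑ j, 2⁻¹ * (coordProd w i j y * pressureKernel (x - y) (b i + b j) -
          coordProd w i j y * pressureKernel (x - y) (b i) - coordProd w i j y * pressureKernel (x - y) (b j)) :=
        integral_congr_ae (Eventually.of_forall fun y => pressureKernel_apply_eq_sum w x y)
    _ = ∑ i, ∫ y in (closedBall x ε)ᶜ, ∑ j, 2⁻¹ * (coordProd w i j y * pressureKernel (x - y) (b i + b j) -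
          coordProd w i j y * pressureKernel (x - y) (b i) - coordProd w i j y * pressureKernel (x - y) (b j)) :=
        integral_finsetSum _ fun i _ => integrable_finsetSum _ fun j _ => hterm i j
    _ = ∑ i, ∑ j, ∫ y in (closedBall x ε)ᶜ, 2⁻¹ * (coordProd w i j y * pressureKernel (x - y) (b i + b j) -
          coordProd w i j y * pressureKernel (x - y) (b i) - coordProd w i j y * pressureKernel (x - y) (b j)) :=
        Finset.sum_congr rfl fun i _ => integral_finsetSum _ fun j _ => hterm i j
    _ = _ := Finset.sum_congr rfl fun i _ => Finset.sum_congr rfl fun j _ => hij i j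

/-- Measurability of the truncated singular integrals of the normalised pressure in `x`. [folklore] -/
theorem aestronglyMeasurable_truncatedPressureIntegral [hpq : ENNReal.HolderConjugate p q] (hq : 1 < q)
    (hq' : q ≠ ⊤) (hw : AEStronglyMeasurable w volume) (hw2 : MemLp (fun x => ‖w x‖ ^ 2) p volume)
    {ε : ℝ} (hε : 0 < ε) : AEStronglyMeasurable (fun x => truncatedPressureIntegral w x ε) volume := by
  have hfun : (fun x => truncatedPressureIntegral w x ε) = fun x => ∑ i, ∑ j, 2⁻¹ *
      (rieszTrunc (stdOrthonormalBasis ℝ ℝ³ i + stdOrthonormalBasis ℝ ℝ³ j) ε (coordProd w i j) x -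
        rieszTrunc (stdOrthonormalBasis ℝ ℝ³ i) ε (coordProd w i j) x -
        rieszTrunc (stdOrthonormalBasis ℝ ℝ³ j) ε (coordProd w i j) x) :=
    funext fun x => truncatedPressureIntegral_eq_sum_rieszTrunc hq hq' hw hw2 x hε
  rw [hfun]
  refine Finset.aestronglyMeasurable_fun_sum _ fun i _ => Finset.aestronglyMeasurable_fun_sum _ fun j _ => ?_
  have hm := fun a => aestronglyMeasurable_rieszTrunc (aestronglyMeasurable_coordProd hw i j) a ε
  exact (((hm _).sub (hm _)).sub (hm _)).const_mul _

/-- **`L^p` bound for the truncated singular integrals of the normalised pressure** (Theorem 3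
(a) on `L^p` for each directional piece, `‖wᵢwⱼ‖_p ≤ ‖|w|²‖_p`):
`‖∫_{|·-y|>ε} K(·-y)(w(y)) dy‖_p ≤ (27/2) A ‖|w|²‖_p`. [cite: Stein1971, Ch. II §4.2 Thm 3 (a)] -/
theorem eLpNorm_truncatedPressureIntegral_le [hpq : ENNReal.HolderConjugate p q] (hq : 1 < q) (hq' : q ≠ ⊤)
    (hp1 : 1 ≤ p) {A : ℝ≥0∞}
    (hA : ∀ ε : ℝ, 0 < ε → ∀ a : ℝ³, ‖a‖ ≤ 2 → ∀ h : ℝ³ → ℝ, MemLp h p volume →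
      eLpNorm (rieszTrunc a ε h) p volume ≤ A * eLpNorm h p volume)
    (hw : AEStronglyMeasurable w volume) (hw2 : MemLp (fun x => ‖w x‖ ^ 2) p volume) {ε : ℝ} (hε : 0 < ε) :
    eLpNorm (fun x => truncatedPressureIntegral w x ε) p volume ≤
      27 * 2⁻¹ * A * eLpNorm (fun x => ‖w x‖ ^ 2) p volume := by
  set b := stdOrthonormalBasis ℝ ℝ³
  set N : ℝ≥0∞ := eLpNorm (fun x => ‖w x‖ ^ 2) p volume with hN
  have hfun : (fun x => truncatedPressureIntegral w x ε) = (2⁻¹ : ℝ) • fun x => ∑ i, ∑ j,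
      (rieszTrunc (b i + b j) ε (coordProd w i j) x - rieszTrunc (b i) ε (coordProd w i j) x -
        rieszTrunc (b j) ε (coordProd w i j) x) := by
    funext x
    rw [truncatedPressureIntegral_eq_sum_rieszTrunc hq hq' hw hw2 x hε]
    simp only [Pi.smul_apply, smul_eq_mul, Finset.mul_sum]
    rfl
  have hcp : ∀ i j, MemLp (coordProd w i j) p volume := memLp_coordProd hw hw2
  have hH : ∀ (i j) (u : ℝ³), ‖u‖ ≤ 2 → eLpNorm (rieszTrunc u ε (coordProd w i j)) p volume ≤ A * N :=
    fun i j u hu => (hA ε hε u hu _ (hcp i j)).trans (mul_le_mul' le_rfl (eLpNorm_coordProd_le w i j p))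
  have hm : ∀ (i j) (u : ℝ³), AEStronglyMeasurable (rieszTrunc u ε (coordProd w i j)) volume :=
    fun i j u => aestronglyMeasurable_rieszTrunc (aestronglyMeasurable_coordProd hw i j) u ε
  have hterm : ∀ i j, eLpNorm (fun x => rieszTrunc (b i + b j) ε (coordProd w i j) x -
      rieszTrunc (b i) ε (coordProd w i j) x - rieszTrunc (b j) ε (coordProd w i j) x) p volume ≤ 3 * (A * N) := by
    intro i j
    calc eLpNorm (fun x => rieszTrunc (b i + b j) ε (coordProd w i j) x -
          rieszTrunc (b i) ε (coordProd w i j) x - rieszTrunc (b j) ε (coordProd w i j) x) p volume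
        ≤ eLpNorm (fun x => rieszTrunc (b i + b j) ε (coordProd w i j) x -
            rieszTrunc (b i) ε (coordProd w i j) x) p volume + eLpNorm (rieszTrunc (b j) ε (coordProd w i j)) p volume :=
          eLpNorm_sub_le ((hm i j _).sub (hm i j _)) (hm i j _) hp1
      _ ≤ (eLpNorm (rieszTrunc (b i + b j) ε (coordProd w i j)) p volume +
            eLpNorm (rieszTrunc (b i) ε (coordProd w i j)) p volume) +
            eLpNorm (rieszTrunc (b j) ε (coordProd w i j)) p volume := by
          gcongr
          exact eLpNorm_sub_le (hm i j _) (hm i j _) hp1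
      _ ≤ (A * N + A * N) + A * N := by
          gcongr
          · exact hH i j _ (norm_stdOrthonormalBasis_add_le i j)
          · exact hH i j _ (norm_stdOrthonormalBasis_le i)
          · exact hH i j _ (norm_stdOrthonormalBasis_le j)
      _ = 3 * (A * N) := by ring
  rw [hfun, eLpNorm_const_smul]
  have hsum : eLpNorm (fun x => ∑ i, ∑ j, (rieszTrunc (b i + b j) ε (coordProd w i j) x -
      rieszTrunc (b i) ε (coordProd w i j) x - rieszTrunc (b j) ε (coordProd w i j) x)) p volume ≤
      (9 : ℕ) • (3 * (A * N)) := by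
    have hfun2 : (fun x => ∑ i, ∑ j, (rieszTrunc (b i + b j) ε (coordProd w i j) x -
        rieszTrunc (b i) ε (coordProd w i j) x - rieszTrunc (b j) ε (coordProd w i j) x)) =
        ∑ i, ∑ j, fun x => (rieszTrunc (b i + b j) ε (coordProd w i j) x -
          rieszTrunc (b i) ε (coordProd w i j) x - rieszTrunc (b j) ε (coordProd w i j) x) := by
      funext x
      simp only [Finset.sum_apply]
    rw [hfun2]
    calc eLpNorm (∑ i, ∑ j, fun x => (rieszTrunc (b i + b j) ε (coordProd w i j) x -
          rieszTrunc (b i) ε (coordProd w i j) x - rieszTrunc (b j) ε (coordProd w i j) x)) p volume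
        ≤ ∑ i, eLpNorm (∑ j, fun x => (rieszTrunc (b i + b j) ε (coordProd w i j) x -
            rieszTrunc (b i) ε (coordProd w i j) x - rieszTrunc (b j) ε (coordProd w i j) x)) p volume :=
          eLpNorm_sum_le (fun i _ => Finset.aestronglyMeasurable_sum _ fun j _ =>
            ((hm i j _).sub (hm i j _)).sub (hm i j _)) hp1
      _ ≤ ∑ i, ∑ j, eLpNorm (fun x => (rieszTrunc (b i + b j) ε (coordProd w i j) x -
            rieszTrunc (b i) ε (coordProd w i j) x - rieszTrunc (b j) ε (coordProd w i j) x)) p volume :=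
          Finset.sum_le_sum fun i _ => eLpNorm_sum_le (fun j _ => ((hm i j _).sub (hm i j _)).sub (hm i j _)) hp1
      _ ≤ ∑ _i : Fin (Module.finrank ℝ ℝ³), ∑ _j : Fin (Module.finrank ℝ ℝ³), 3 * (A * N) :=
          Finset.sum_le_sum fun i _ => Finset.sum_le_sum fun j _ => hterm i j
      _ = (9 : ℕ) • (3 * (A * N)) := by
          rw [Finset.sum_const, Finset.sum_const, Finset.card_univ, Fintype.card_fin,
            finrank_euclideanSpace_fin, smul_smul]
          norm_num
  have h2 : ‖(2⁻¹ : ℝ)‖ₑ = 2⁻¹ := by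
    rw [Real.enorm_eq_ofReal (by norm_num), ENNReal.ofReal_inv_of_pos (by norm_num), ENNReal.ofReal_ofNat]
  rw [h2]
  calc (2⁻¹ : ℝ≥0∞) * eLpNorm (fun x => ∑ i, ∑ j, (rieszTrunc (b i + b j) ε (coordProd w i j) x -
        rieszTrunc (b i) ε (coordProd w i j) x - rieszTrunc (b j) ε (coordProd w i j) x)) p volume
      ≤ 2⁻¹ * ((9 : ℕ) • (3 * (A * N))) := mul_le_mul' le_rfl hsum
    _ = 27 * 2⁻¹ * A * N := by
        rw [nsmul_eq_mul]
        push_cast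
        ring

end Truncated

/-! ## §3. The principal values exist almost everywhere -/

section AE

variable {p : ℝ≥0∞} {w : ℝ³ → ℝ³}

/-- **The principal value `p.v.∫ K(x-y)(w(y)) dy` exists for a.e. `x`** when `w` is measurable
with `|w|² ∈ L^p`, `1 < p < ∞` (Theorem 4 (a) for each of the 27 directional truncations of the
polarisation, and the integrability of the truncated integrands for every `ε > 0`).
[cite: Stein1971, Ch. II §4.5 Thm 4 (a)] -/
theorem ae_exists_hasPressurePV (hp1 : 1 < p) (hp2 : p < ⊤) (hw : AEStronglyMeasurable w volume)
    (hw2 : MemLp (fun x => ‖w x‖ ^ 2) p volume) : ∀ᵐ x : ℝ³, ∃ L, HasPressurePV w x L := by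
  set b := stdOrthonormalBasis ℝ ℝ³
  -- conjugate exponent
  set q : ℝ≥0∞ := ENNReal.conjExponent p with hq
  haveI hpq : ENNReal.HolderConjugate p q := ENNReal.HolderConjugate.conjExponent hp1.le
  have hq1 : 1 < q := (ENNReal.HolderConjugate.lt_top_iff_one_lt p q).1 hp2
  have hqt : q ≠ ⊤ := (ENNReal.HolderConjugate.ne_top_iff_ne_one q p).2 (ne_of_gt hp1)
  have hcp : ∀ i j, MemLp (coordProd w i j) p volume := memLp_coordProd hw hw2
  -- the 27 scalar limits exist a.e.
  have hae : ∀ᵐ x : ℝ³, ∀ ij : Fin (Module.finrank ℝ ℝ³) × Fin (Module.finrank ℝ ℝ³),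
      (∃ L₁ : ℝ, Tendsto (fun ε => rieszTrunc (b ij.1 + b ij.2) ε (coordProd w ij.1 ij.2) x) (𝓝[>] 0) (𝓝 L₁)) ∧
      (∃ L₂ : ℝ, Tendsto (fun ε => rieszTrunc (b ij.1) ε (coordProd w ij.1 ij.2) x) (𝓝[>] 0) (𝓝 L₂)) ∧
      (∃ L₃ : ℝ, Tendsto (fun ε => rieszTrunc (b ij.2) ε (coordProd w ij.1 ij.2) x) (𝓝[>] 0) (𝓝 L₃)) := by
    rw [ae_all_iff]
    intro ij
    exact ((ae_exists_tendsto_rieszTrunc hp1 hp2 (norm_stdOrthonormalBasis_add_le ij.1 ij.2) (hcp ij.1 ij.2)).and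
      ((ae_exists_tendsto_rieszTrunc hp1 hp2 (norm_stdOrthonormalBasis_le ij.1) (hcp ij.1 ij.2)).and
        (ae_exists_tendsto_rieszTrunc hp1 hp2 (norm_stdOrthonormalBasis_le ij.2) (hcp ij.1 ij.2))))
  filter_upwards [hae] with x hx
  choose L₁ hL₁ using fun ij => (hx ij).1
  choose L₂ hL₂ using fun ij => (hx ij).2.1
  choose L₃ hL₃ using fun ij => (hx ij).2.2
  refine ⟨∑ i, ∑ j, 2⁻¹ * (L₁ (i, j) - L₂ (i, j) - L₃ (i, j)), ?_, ?_⟩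
  · exact eventually_mem_nhdsWithin.mono fun ε hε => integrableOn_pressureKernel_of_memLp hq1 hqt hw hw2 x hε
  · have hfun : truncatedPressureIntegral w x = fun ε => if 0 < ε then ∑ i, ∑ j, 2⁻¹ *
        (rieszTrunc (b i + b j) ε (coordProd w i j) x - rieszTrunc (b i) ε (coordProd w i j) x -
          rieszTrunc (b j) ε (coordProd w i j) x) else truncatedPressureIntegral w x ε := by
      funext ε
      split_ifs with hε
      · exact truncatedPressureIntegral_eq_sum_rieszTrunc hq1 hqt hw hw2 x hε
      · rfl
    have hlim : Tendsto (fun ε => ∑ i, ∑ j, 2⁻¹ *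
        (rieszTrunc (b i + b j) ε (coordProd w i j) x - rieszTrunc (b i) ε (coordProd w i j) x -
          rieszTrunc (b j) ε (coordProd w i j) x)) (𝓝[>] 0)
        (𝓝 (∑ i, ∑ j, 2⁻¹ * (L₁ (i, j) - L₂ (i, j) - L₃ (i, j)))) :=
      tendsto_finsetSum _ fun i _ => tendsto_finsetSum _ fun j _ =>
        (((hL₁ (i, j)).sub (hL₂ (i, j))).sub (hL₃ (i, j))).const_mul _
    refine hlim.congr' ?_
    filter_upwards [self_mem_nhdsWithin] with ε hε
    exact (truncatedPressureIntegral_eq_sum_rieszTrunc hq1 hqt hw hw2 x hε).symm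

end AE

/-! ## §4. The discharge -/

/-- **Discharge of `stein1970_normalisedPressure_ae_Lp_bound`** (Stein 1970, Ch. II §4.2
Theorem 3 (b) with §4.5 Theorem 4 (a), for the Riesz-type kernels of the normalised pressure on
the `L^p` class): for every `1 < p < ∞` there is `C` such that for every measurable
`w : ℝ³ → ℝ³` with `|w|² ∈ L^p` the principal value `p.v.∫ K(x-y)(w(y)) dy` exists for a.e. `x`
and `‖p̃[w]‖_{L^p} ≤ C ‖|w|²‖_{L^p}` (`C = 1/3 + 27A_p/2`, `A_p` the constant of Theorem 3 (a)
on `L^p`; the a.e. limit is controlled in `L^p` by Fatou along `ε = 1/(n+1)`). Proved by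
Calderón–Zygmund theory, the Hardy–Littlewood maximal theorem and Cotlar's majorisation
(`SingularIntegrals/`, `RieszPressure*`). [cite: Stein1971, Ch. II §4.2 Thm 3 (b) and §4.5 Thm 4 (a)] -/
theorem stein1970_normalisedPressure_ae_Lp_bound_holds : stein1970_normalisedPressure_ae_Lp_bound := by
  intro p hp1 hp2
  obtain ⟨A, hAt, hA⟩ := exists_eLpNorm_rieszTrunc_le hp1 hp2
  refine ⟨3⁻¹ + 27 * 2⁻¹ * A.toNNReal, fun w hw hw2 => ?_⟩
  have hp1' : 1 ≤ p := hp1.le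
  -- conjugate exponent
  set q : ℝ≥0∞ := ENNReal.conjExponent p with hq
  haveI hpq : ENNReal.HolderConjugate p q := ENNReal.HolderConjugate.conjExponent hp1.le
  have hq1 : 1 < q := (ENNReal.HolderConjugate.lt_top_iff_one_lt p q).1 hp2
  have hqt : q ≠ ⊤ := (ENNReal.HolderConjugate.ne_top_iff_ne_one q p).2 (ne_of_gt hp1)
  have hPV := ae_exists_hasPressurePV hp1 hp2 hw hw2
  refine ⟨hPV, ?_⟩
  set N : ℝ≥0∞ := eLpNorm (fun x => ‖w x‖ ^ 2) p volume with hN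
  -- the a.e. limit of the truncations
  set L : ℝ³ → ℝ := fun x => limUnder (𝓝[>] (0 : ℝ)) (truncatedPressureIntegral w x) with hL
  set Tn : ℕ → ℝ³ → ℝ := fun n x => truncatedPressureIntegral w x (1 / ((n : ℝ) + 1)) with hTn
  have hseq : Tendsto (fun n : ℕ => 1 / ((n : ℝ) + 1)) atTop (𝓝[>] 0) := by
    rw [tendsto_nhdsWithin_iff]
    exact ⟨tendsto_one_div_add_atTop_nhds_zero_nat,
      Eventually.of_forall fun n => mem_Ioi.2 (one_div_pos.2 (Nat.cast_add_one_pos n))⟩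
  have hTlim : ∀ᵐ x, Tendsto (fun n => Tn n x) atTop (𝓝 (L x)) := by
    filter_upwards [hPV] with x hx
    obtain ⟨L', hL'⟩ := hx
    have hlim : Tendsto (truncatedPressureIntegral w x) (𝓝[>] 0) (𝓝 (L x)) := by
      rw [hL]
      simp only
      rw [hL'.2.limUnder_eq]
      exact hL'.2
    exact hlim.comp hseq
  have hpt : ∀ᵐ x, normalisedPressure w x = -‖w x‖ ^ 2 / 3 + L x := by
    filter_upwards [hPV] with x hx
    obtain ⟨L', hL'⟩ := hx
    have hLL : L x = L' := by rw [hL]; simp only; exact hL'.2.limUnder_eq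
    rw [normalisedPressure_eq hL', finrank_euclideanSpace_fin, hLL]
    push_cast
    ring
  -- measurability
  have hTm : ∀ n, AEStronglyMeasurable (Tn n) volume := fun n =>
    aestronglyMeasurable_truncatedPressureIntegral hq1 hqt hw hw2 (one_div_pos.2 (Nat.cast_add_one_pos n))
  have hLm : AEStronglyMeasurable L volume := aestronglyMeasurable_of_tendsto_ae atTop hTm hTlim
  have hqm : AEStronglyMeasurable (fun x => -‖w x‖ ^ 2 / 3) volume :=
    ((hw.norm.aemeasurable.pow_const 2).neg.div_const 3).aestronglyMeasurable
  -- Fatou for `L`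
  have hLbd : eLpNorm L p volume ≤ 27 * 2⁻¹ * A * N := by
    have hF := Lp.eLpNorm_lim_le_liminf_eLpNorm (p := p) hTm L hTlim
    refine hF.trans (liminf_le_of_frequently_le' (Eventually.of_forall fun n => ?_).frequently)
    exact eLpNorm_truncatedPressureIntegral_le hq1 hqt hp1' (fun ε hε a ha h hh => hA ε hε a ha h hh) hw hw2
      (one_div_pos.2 (Nat.cast_add_one_pos n))
  -- the quadratic term
  have hQ : eLpNorm (fun x => -‖w x‖ ^ 2 / 3) p volume = 3⁻¹ * N := by
    have hfun : (fun x => -‖w x‖ ^ 2 / 3) = (-(3⁻¹ : ℝ)) • fun x => ‖w x‖ ^ 2 := by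
      funext x; simp only [Pi.smul_apply, smul_eq_mul]; ring
    rw [hfun, eLpNorm_const_smul, enorm_neg, Real.enorm_eq_ofReal (by norm_num),
      ENNReal.ofReal_inv_of_pos (by norm_num), ENNReal.ofReal_ofNat]
  -- assemble
  have hA' : ((A.toNNReal : ℝ≥0) : ℝ≥0∞) = A := ENNReal.coe_toNNReal hAt
  calc eLpNorm (normalisedPressure w) p volume = eLpNorm (fun x => -‖w x‖ ^ 2 / 3 + L x) p volume :=
        eLpNorm_congr_ae hpt
    _ ≤ eLpNorm (fun x => -‖w x‖ ^ 2 / 3) p volume + eLpNorm L p volume := eLpNorm_add_le hqm hLm hp1'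
    _ ≤ 3⁻¹ * N + 27 * 2⁻¹ * A * N := by rw [hQ]; exact add_le_add le_rfl hLbd
    _ = ((3⁻¹ + 27 * 2⁻¹ * A.toNNReal : ℝ≥0) : ℝ≥0∞) * N := by
        push_cast
        rw [hA']
        ring

end Literature.Analysis.FluidPDE
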